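import HarnessLib
import Summits.ResolutionOfSingularities.Statement
import Literature.AlgebraicGeometry.Resolution.BlowupSequencesExtensions
import Literature.AlgebraicGeometry.Resolution.HilbertSamuelValues
import Literature.AlgebraicGeometry.CossartJannsenSaito2020.KeyTheorems
import Literature.AlgebraicGeometry.CossartJannsenSaito2020.KeyTheoremsIsolated
import Literature.AlgebraicGeometry.CossartJannsenSaito2020.KeyTheoremsLocal
import Literature.AlgebraicGeometry.CossartJannsenSaito2020.KeyTheoremsAPI
import Literature.AlgebraicGeometry.CossartJannsenSaito2020.NearPointProjDirectrix
import Literature.AlgebraicGeometry.CossartJannsenSaito2020.NearFibreNormalDirectrix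
import Summits.ResolutionOfSingularities.ResolutionOfSingularities.Theorems.ForcedTowerClasses
import Summits.ResolutionOfSingularities.ResolutionOfSingularities.Theorems.DivergentTowerClasses
import Summits.ResolutionOfSingularities.ResolutionOfSingularities.Theorems.MonomialTowerClasses
import Summits.ResolutionOfSingularities.ResolutionOfSingularities.Theorems.HugDimensionClasses
import Summits.ResolutionOfSingularities.ResolutionOfSingularities.Theorems.HugDimensionKernels
import Summits.ResolutionOfSingularities.ResolutionOfSingularities.Theorems.SurfaceShadowClasses
import Summits.ResolutionOfSingularities.ResolutionOfSingularities.Theorems.SurfaceShadowKernels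
import Summits.ResolutionOfSingularities.ResolutionOfSingularities.Theorems.CornerTowerDynamics

/-!
# NearPointCutRealisation — §1–§2 of the decomp-res node «NearPointCut» v3 (lens-4 g13/g14, HOME
decomp-res-lens-4/g14/NearPointCut.lean sha256 f6cc5d14e40b8f11; critic rows 81/92/95 CLEARED)

Tree file 1/4, route-independent: §1 Layer A — the PROVED combinatorics of the extremal move (Hilbert–Samuel
stabilisation of antitone sequences in a partial well-order), and §2 the Hilbert–Samuel REALISATION
`HSRealisation` of a hugged
singular surface germ pinned to a forced tower, with its ledger `Lineage` and the PROVED ledger lemmas — VERBATIM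
from the lens
file (v3 = v2 + critic F-c′; the `isolated` clause of v1 removed per critic row 81 F-a).  The node record (lens header) is in
`NearPointCutClasses` (file 2/4); kernels in `NearPointCutKernels`; the up-links to 32260 BY NAME in
`MaxContactCutNearPointCut`.
[WRITER NOTE (decomp-res writer g5): the two option lines of the lens file and `import Mathlib` are dropped (house style).]
(Sources: CossartJannsenSaito2020 Thm. 3.14, Cor. 6.37, Thm. 6.40; Hironaka1964.)
-/

open CategoryTheory AlgebraicGeometry
open Literature.RingTheory.HilbertSamuel
open Literature.AlgebraicGeometry.Resolution
open Literature.AlgebraicGeometry.CossartJannsenSaito2020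
open Summit.ResolutionOfSingularities.ResolutionOfSingularities.Theorems
open WeakOrderReduction ForcedTowerClasses DivergentTowerClasses MonomialTowerClasses
open HugDimensionClasses HugDimensionKernels SurfaceShadowClasses SurfaceShadowKernels

namespace Summit.ResolutionOfSingularities.ResolutionOfSingularities.Theorems.NearPointCut

/-! ## §1 Layer A — PROVED combinatorics of the extremal move (no geometry) -/

/-- **HILBERT–SAMUEL STABILISATION, abstract form**: an antitone sequence with values in a partially well-ordered
set is eventually constant (the extremal move: MINIMISE `H` along the tower). [folklore] -/
theorem eventually_const_of_antitone {α : Type*} [PartialOrder α] {H : ℕ → α} (hanti : Antitone H)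
    (hpwo : (Set.range H).IsPWO) : ∃ a, ∀ i, a ≤ i → H i = H a := by
  have hwf : (Set.range H).IsWF := hpwo.isWF
  have hne : (Set.range H).Nonempty := ⟨H 0, 0, rfl⟩
  obtain ⟨a, ha⟩ : ∃ a, H a = hwf.min hne := hwf.min_mem hne
  refine ⟨a, fun i hi => ?_⟩
  have hle : H i ≤ H a := hanti hi
  by_contra hneq
  exact hwf.not_lt_min hne (Set.mem_range_self i) (ha ▸ lt_of_le_of_ne hle hneq)

/-- **DIRECTRIX DICHOTOMY, abstract form**: a sequence with values in `{1, 2}` in which the value `1` persists is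
either eventually `≡ 1` or identically `≡ 2`. [folklore] -/
theorem dichotomy_nat (e : ℕ → ℕ) (a : ℕ) (hpos : ∀ i, a ≤ i → 1 ≤ e i) (hle : ∀ i, a ≤ i → e i ≤ 2)
    (hpersist : ∀ i, a ≤ i → e i = 1 → e (i + 1) ≤ 1) :
    (∃ b, a ≤ b ∧ ∀ i, b ≤ i → e i = 1) ∨ (∀ i, a ≤ i → e i = 2) := by
  by_cases h : ∃ b, a ≤ b ∧ e b = 1
  · obtain ⟨b, hab, hb⟩ := h
    refine Or.inl ⟨b, hab, fun i hi => ?_⟩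
    obtain ⟨d, rfl⟩ := Nat.exists_eq_add_of_le hi
    clear hi
    induction d with
    | zero => simpa using hb
    | succ d ih =>
      have h1 : e (b + d) = 1 := ih
      have h2 := hpersist (b + d) (by omega) h1
      have h3 := hpos (b + d + 1) (by omega)
      rw [← Nat.add_assoc]
      omega
  · push Not at h
    exact Or.inr fun i hi => by
      have h1 := h i hi
      have h2 := hpos i hi
      have h3 := hle i hi
      omega

/-- Persistence downwards along a lineage: alive at stage `j + d` and born by stage `j` ⟹ alive at stage `j`.
[folklore] -/
theorem on_of_le {κ : Type*} {birth : κ → ℕ} {on : ℕ → κ → Prop}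
    (persist : ∀ i c, birth c ≤ i → on (i + 1) c → on i c) (c : κ) (j : ℕ) (hbj : birth c ≤ j) :
    ∀ d, on (j + d) c → on j c
  | 0, h => h
  | d + 1, h => on_of_le persist c j hbj d (persist (j + d) c (by omega) h)

/-- **THE LINEAGE FINITENESS LEMMA (heart of the residual's normal form), abstract form.**  Curves `c : κ` with a
birth stage, `on i c` = «the marked point of stage `i` lies on the stage-`i` transform of `c`»; AXIOMS: a curve is
alive only after its birth; persistence downwards; finitely many curves through each marked point; every curve is
left eventually (mortality); a curve born at stage `i + 1 > a` through the marked point needs the event `New i`.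
CONCLUSION: if `New` happens only finitely often, then from some stage on NO curve passes through the marked point.
[folklore] -/
theorem eventually_free {κ : Type*} (birth : κ → ℕ) (on : ℕ → κ → Prop) (New : ℕ → Prop) (a : ℕ)
    (birth_le : ∀ i c, on i c → birth c ≤ i)
    (persist : ∀ i c, birth c ≤ i → on (i + 1) c → on i c)
    (finite : ∀ i, {c | on i c}.Finite)
    (mortal : ∀ c, ∃ i, birth c ≤ i ∧ ¬ on i c)
    (newborn : ∀ i c, a ≤ i → birth c = i + 1 → on (i + 1) c → New i)
    (hdry : ∃ j₀, ∀ j, j₀ ≤ j → ¬ New j) :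
    ∃ b, ∀ i, b ≤ i → ∀ c, ¬ on i c := by
  obtain ⟨j₀, hj₀⟩ := hdry
  obtain ⟨b₀, hab₀, hjb₀⟩ : ∃ b₀, a ≤ b₀ ∧ j₀ < b₀ := ⟨max a j₀ + 1, by omega, by omega⟩
  -- every curve through the marked point at a stage `i ≥ b₀` already passes through it at stage `b₀`
  have key : ∀ i, b₀ ≤ i → ∀ c, on i c → on b₀ c := by
    intro i hi c hc
    have hb : birth c ≤ i := birth_le i c hc
    by_cases hcb : birth c ≤ b₀
    · obtain ⟨d, rfl⟩ := Nat.exists_eq_add_of_le hi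
      exact on_of_le persist c b₀ hcb d hc
    · exfalso
      obtain ⟨i', hi'⟩ : ∃ i', birth c = i' + 1 := ⟨birth c - 1, by omega⟩
      obtain ⟨d, rfl⟩ := Nat.exists_eq_add_of_le hb
      have hon : on (birth c) c := on_of_le persist c (birth c) le_rfl d hc
      rw [hi'] at hon
      exact hj₀ i' (by omega) (newborn i' c (by omega) hi' hon)
  -- the finitely many curves through the marked point of stage `b₀` all die; take the last death
  choose d hd using mortal
  refine ⟨b₀ + (finite b₀).toFinset.sup d, fun i hi c hc => ?_⟩
  have hcb₀ : on b₀ c := key i (le_trans (Nat.le_add_right _ _) hi) c hc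
  have hmem : c ∈ (finite b₀).toFinset := (finite b₀).mem_toFinset.mpr hcb₀
  have hdc : d c ≤ (finite b₀).toFinset.sup d := Finset.le_sup hmem
  obtain ⟨e, rfl⟩ := Nat.exists_eq_add_of_le (show d c ≤ i by omega)
  exact (hd c).2 (on_of_le persist c (d c) (hd c).1 e hc)

/-! ## §2 The Hilbert–Samuel REALISATION of a hugged singular surface germ (port output, pinned to the tower) -/

/-- **A HILBERT–SAMUEL REALISATION of a hugged surface germ of the forced tower `T`**: a hugged two-dimensional germ
`V(germ) ∋ pt m` together with the CJS point blow-up tower `S` of its local scheme — stages `S.X i`, marked CLOSED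
points `y i`, every centre the marked point, `π (y (i+1)) = y i` — PINNED to `T` by `stalkIso`: the local ring of
`S.X i` at `y i` IS the local ring `𝒪_{St (m+i), pt (m+i)} / (strict transform of germ)` of the hugged germ's `i`-th
strict transform; plus the STANDING FACTS the typed CJS engines read (excellent stages of dimension `≤ 2` = the level
`N = 2`; characteristic hypothesis, automatic in dimension two; point centres permissible; `H` non-increasing under
point blow-ups, CJS Thm. 3.10 (1) / tree `IsBlowup.hsFun_le_of_isClosed_point_centre_of_isQuasiExcellent`;
`1 ≤ e ≤ ē ≤ 2` at near points, CJS Thm. 3.14 / Def. 2.26; persistence of `e = 1` at near points, CJS Thm. 3.10 (4)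
with `k(x') = k(x)` from tree `ProjDir_line`).  Delivered by the COSTUME port `Realisation`; every invariant read
below (`H`, `e`, quasi-isolation, near lines) is a LOCAL-RING invariant at the marked points, hence an invariant
of the hugged germ itself. -/
structure HSRealisation (T : ForcedTower) : Type 1 where
  /-- the hugging stage -/
  m : ℕ
  /-- the hugged two-dimensional germ `V(germ) ∋ pt m` -/
  germ : (T.St m).IdealSheafData
  /-- it is hugged for ever -/
  hugs : HugsGerm T m germ
  /-- its local ring has Krull dimension two -/
  dim_two : ringKrullDim ((T.St m).presheaf.stalk (T.pt m) ⧸ stalkIdeal germ (T.pt m)) = (2 : WithBot ℕ∞)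
  /-- the point blow-up tower of the germ (CJS `BlowupTower`) -/
  S : BlowupTower.{0}
  /-- the marked points -/
  y : ∀ i, S.X i
  /-- every centre is the marked point -/
  centre_eq : ∀ i, S.C i = {y i}
  /-- the marked points lie over each other -/
  y_map : ∀ i, (S.π i).base (y (i + 1)) = y i
  /-- the marked points are closed -/
  isClosed_y : ∀ i, IsClosed ({y i} : Set (S.X i))
  /-- PIN: `𝒪_{S.X i, y i} ≅ 𝒪_{St (m+i), pt (m+i)} / (i-th strict transform of the germ)` -/
  stalkIso : ∀ i, Nonempty ((S.X i).presheaf.stalk (y i) ≃+*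
    ((T.St (m + i)).presheaf.stalk (T.pt (m + i)) ⧸ stalkIdeal (strictIter T m germ i) (T.pt (m + i))))
  /-- every stage is excellent of dimension `≤ 2` (CJS Setup C; the level is `N = 2`) -/
  setting : ∀ a, KeySetting (S.drop a) 2
  /-- `char k(y i) = 0 ∨ dim + 2 ≤ 2·char`: automatic for `dim = 2` -/
  charHyp : ∀ i, CharHypothesis (S.X i) (y i)
  /-- closed points are permissible centres (CJS Def. 3.1) -/
  permissible : ∀ i, IdealSheafData.IsPermissible (S.centreIdeal i)
  /-- `H` does not increase under the point blow-ups (CJS Thm. 3.10 (1)) -/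
  hmono : ∀ i, Scheme.hsFun (S.X (i + 1)) 2 (y (i + 1)) ≤ Scheme.hsFun (S.X i) 2 (y i)
  /-- `e ≤ dim = 2` (CJS Def. 2.26) -/
  dirDim_le : ∀ i, S.dirDimAt i (y i) ≤ 2
  /-- `e = 2 ⟹ ē = 2` (`e ≤ ē ≤ dim = 2`, CJS Def. 2.26) -/
  geomDirDim_of_two : ∀ i, S.dirDimAt i (y i) = 2 → S.geomDirDimAt i (y i) = 2
  /-- a near point exists over `y i` ⟹ `1 ≤ e_{y i}` (CJS Thm. 3.14 = tree `CossartJannsenSaito2020_thm_3_14`) -/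
  dirDim_pos : ∀ i, Scheme.hsFun (S.X (i + 1)) 2 (y (i + 1)) = Scheme.hsFun (S.X i) 2 (y i) → 1 ≤ S.dirDimAt i (y i)
  /-- `e = 1` persists at near points (CJS Thm. 3.10 (4) `e_{x'} ≤ e_x(X)_{k(x')}`, `k(x') = k(x)` by tree `ProjDir_line`) -/
  dirDim_one_persist : ∀ i, Scheme.hsFun (S.X (i + 1)) 2 (y (i + 1)) = Scheme.hsFun (S.X i) 2 (y i) →
    S.dirDimAt i (y i) = 1 → S.dirDimAt (i + 1) (y (i + 1)) ≤ 1

namespace HSRealisation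

variable {T : ForcedTower} (R : HSRealisation T)

/-- `H_i := H^{(2)}_{S.X i}(y i)`, the Hilbert–Samuel function of the germ's `i`-th strict transform at the point. -/
@[reducible] noncomputable def H (i : ℕ) : ℕ → ℕ := Scheme.hsFun (R.S.X i) 2 (R.y i)

/-- `e_i := e_{y i}(S.X i)`, the directrix dimension. -/
@[reducible] noncomputable def e (i : ℕ) : ℕ := R.S.dirDimAt i (R.y i)

/-- STABLE from stage `a`: every later marked point is NEAR (`H_{i+1} = H_i`, CJS Def. 3.13). -/
def StableFrom (a : ℕ) : Prop := ∀ i, a ≤ i → R.H (i + 1) = R.H i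

/-- `e ≡ 1` from stage `b`. -/
def DirOneFrom (b : ℕ) : Prop := ∀ i, b ≤ i → R.e i = 1

/-- `e ≡ 2` from stage `a`. -/
def DirTwoFrom (a : ℕ) : Prop := ∀ i, a ≤ i → R.e i = 2

/-- QUASI-ISOLATED at stage `i` = THE PRINTED HYPOTHESIS OF CJS Thm. 6.40 at `y i`: no regular curve germ through
`y i` inside the Hilbert–Samuel locus `{H ≥ H(y i)}` of `Spec 𝒪_{S.X i, y i}` (tree
`NoRegularSubschemeInHSLocus … 1`). -/
def QI (i : ℕ) : Prop := @NoRegularSubschemeInHSLocus (R.S.X i) (R.S.ln i) 2 (R.y i) 1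

/-- quasi-isolated from stage `b` on. -/
def QIFrom (b : ℕ) : Prop := ∀ i, b ≤ i → R.QI i

/-- ISOLATED in the Hilbert–Samuel locus at stage `i` (the printed hypothesis of CJS Cor. 6.37). -/
def Isolated (i : ℕ) : Prop := @IsIsolatedInHSMaxLocus (R.S.X i) (R.S.ln i) 2 (R.y i)

/-- (v2) the realisation is LOCAL AT STAGE 0: `S.X 0 = Spec 𝒪_{S.X 0, y 0}` (tree `IsLocalAt`). -/
def LocalAtZero : Prop := IsLocalAt (R.S.X 0) (R.y 0)

/-- **THE NEAR LINE at stage `i`** (the residual phenomenon): `e_i = 2` and EVERY point of the exceptional line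
`ℙ(Dir_{y i}) ≅ ℙ¹_{k(y i)} ⊂ S.X (i+1)` is near to `y i` (`H ≡ H_i` on it; CJS: `δ ≥ 2`, their fundamental unit
would blow up this LINE, a point tower cannot). -/
def NearLine (i : ℕ) : Prop :=
  R.e i = 2 ∧ ∀ ξ ∈ (R.S.drop i).projDir (R.y i), Scheme.hsFun (R.S.X (i + 1)) 2 ξ = R.H i

/-- near lines infinitely often. -/
def NearLineRecurrent : Prop := ∀ j₀, ∃ j, j₀ ≤ j ∧ R.NearLine j

/-- quasi-isolation fails infinitely often. -/
def NonQIRecurrent : Prop := ∀ b, ∃ i, b ≤ i ∧ ¬ R.QI i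

/-- pure logic. [folklore] -/
theorem stableFrom_mono {a b : ℕ} (h : R.StableFrom a) (hab : a ≤ b) : R.StableFrom b :=
  fun i hi => h i (le_trans hab hi)

/-- pure logic. [folklore] -/
theorem dirTwoFrom_mono {a b : ℕ} (h : R.DirTwoFrom a) (hab : a ≤ b) : R.DirTwoFrom b :=
  fun i hi => h i (le_trans hab hi)

/-- pure logic. [folklore] -/
theorem dirOneFrom_mono {a b : ℕ} (h : R.DirOneFrom a) (hab : a ≤ b) : R.DirOneFrom b :=
  fun i hi => h i (le_trans hab hi)

/-- pure logic. [folklore] -/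
theorem qiFrom_mono {a b : ℕ} (h : R.QIFrom a) (hab : a ≤ b) : R.QIFrom b :=
  fun i hi => h i (le_trans hab hi)

/-- **KERNEL (PROVED) — HILBERT–SAMUEL STABILISATION along the realisation**: `H_i` is antitone (port field
`hmono`) with values in the partially well-ordered candidate set of the tree (`isPWO_hsValueSet`,
`Scheme.hsFun_mem_hsValueSet_of_le`), hence eventually constant: from some stage on every marked point is NEAR.
(Sources: CossartJannsenSaito2020, Thm. 2.15, Thm. 6.17 (proof, p. 85).) -/
theorem exists_stableFrom : ∃ a, R.StableFrom a := by
  have hanti : Antitone R.H := antitone_nat_of_succ_le fun i => R.hmono i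
  have hsub : Set.range R.H ⊆ hsValueSet ℚ (R.H 0 1) 2 := by
    rintro _ ⟨i, rfl⟩
    haveI := R.S.ln i
    exact Scheme.hsFun_mem_hsValueSet_of_le ℚ (hanti (Nat.zero_le i))
  obtain ⟨a, ha⟩ := eventually_const_of_antitone hanti ((isPWO_hsValueSet ℚ (R.H 0 1) 2).mono hsub)
  exact ⟨a, fun i hi => (ha (i + 1) (by omega)).trans (ha i hi).symm⟩

/-- **KERNEL (PROVED) — THE DIRECTRIX DICHOTOMY**: on the stable range `e_i ∈ {1, 2}` and `e = 1` persists, so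
either `e ≡ 1` eventually or `e ≡ 2` throughout. (Sources: CossartJannsenSaito2020, Thm. 3.10 (4), Thm. 3.14.) -/
theorem dichotomy {a : ℕ} (hst : R.StableFrom a) : (∃ b, a ≤ b ∧ R.DirOneFrom b) ∨ R.DirTwoFrom a :=
  dichotomy_nat R.e a (fun i hi => R.dirDim_pos i (hst i hi)) (fun i _ => R.dirDim_le i)
    (fun i hi h1 => R.dirDim_one_persist i (hst i hi) h1)

/-- **THE HS-CURVE LINEAGE LEDGER of a realisation from its stable stage `a`** (output of the COSTUME port
`LineagePort`): the curve germs `c : κ` of the Hilbert–Samuel locus (`H ≡ ν` generically) through the marked points,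
organised in LINEAGES (strict transforms = the same `c`; `birth c` = first stage of existence; `on i c` = `y i` lies
on the stage-`i` transform), with the five bookkeeping axioms of `eventually_free` and the four LINKS to the typed
CJS notions: a failure of quasi-isolation is witnessed by a ledger curve (`cover`); a curve BORN after `a` through the
marked point is the near line of the previous stage (`newborn`: an exceptional HS-curve lies in the near locus
`⊂ ℙ(Dir)`, CJS Thm. 3.14, so it IS `ℙ(Dir)` and `e = 2`); a near line destroys quasi-isolation at the next marked
point (`witness`: `ℙ¹_{k}` is regular).  (v2/v3: the isolation link is no longer a ledger axiom — it is the separate,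
ledger-free COSTUME port `IsolationPort` for LOCAL, STABLE, `e ≡ 1` realisations of singular-class towers.)
Mortality = `¬ CurveHugging T` through the pin. -/
structure Lineage (a : ℕ) : Type 1 where
  /-- the HS-curve lineages -/
  κ : Type
  /-- first stage at which the lineage exists -/
  birth : κ → ℕ
  /-- the marked point of stage `i` lies on the stage-`i` member of the lineage -/
  on : ℕ → κ → Prop
  /-- alive only after birth -/
  birth_le : ∀ i c, on i c → birth c ≤ i
  /-- persistence downwards (`π` maps the transform onto the previous member) -/
  persist : ∀ i c, birth c ≤ i → on (i + 1) c → on i c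
  /-- finitely many HS-curves through each marked point (noetherian HS-locus of dimension `≤ 1`) -/
  finite : ∀ i, {c | on i c}.Finite
  /-- every HS-curve is left eventually (`¬ CurveHugging T`, through the pin `stalkIso`) -/
  mortal : ∀ c, ∃ i, birth c ≤ i ∧ ¬ on i c
  /-- an HS-curve born at stage `i + 1 > a` through `y (i+1)` is the near line of stage `i` -/
  newborn : ∀ i c, a ≤ i → birth c = i + 1 → on (i + 1) c → R.NearLine i
  /-- a failure of quasi-isolation is witnessed by a ledger curve -/
  cover : ∀ i, a ≤ i → ¬ R.QI i → ∃ c, on i c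
  /-- the near line of stage `i` is a regular HS-curve through `y (i+1)` -/
  witness : ∀ i, a ≤ i → R.NearLine i → ¬ R.QI (i + 1)

namespace Lineage

variable {R} {a : ℕ}

/-- **KERNEL (PROVED) — finitely many near lines ⟹ eventually quasi-isolated AND CURVE-FREE** (no ledger curve
through the marked point). [folklore] -/
theorem exists_free (L : R.Lineage a) (hdry : ∃ j₀, ∀ j, j₀ ≤ j → ¬ R.NearLine j) :
    ∃ b, a ≤ b ∧ R.QIFrom b ∧ ∀ i, b ≤ i → ∀ c, ¬ L.on i c := by
  obtain ⟨b, hb⟩ := eventually_free L.birth L.on R.NearLine a L.birth_le L.persist L.finite L.mortal L.newborn hdry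
  refine ⟨max a b, le_max_left _ _, fun i hi => ?_, fun i hi => hb i (le_trans (le_max_right _ _) hi)⟩
  by_contra hq
  obtain ⟨c, hc⟩ := L.cover i (le_trans (le_max_left _ _) hi) hq
  exact hb i (le_trans (le_max_right _ _) hi) c hc

/-- **KERNEL (PROVED) — THE NORMAL FORM OF THE RESIDUAL: quasi-isolation fails infinitely often ⟹ near lines
infinitely often.** [folklore] -/
theorem nearLineRecurrent_of_nonQI (L : R.Lineage a) (h : R.NonQIRecurrent) : R.NearLineRecurrent := by
  intro j₀
  by_contra hc
  push Not at hc
  obtain ⟨b, -, hq, -⟩ := L.exists_free ⟨j₀, hc⟩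
  obtain ⟨i, hi, hni⟩ := h b
  exact hni (hq i hi)

/-- **KERNEL (PROVED) — converse: near lines infinitely often ⟹ quasi-isolation fails infinitely often** (so the
normal form is EXACT modulo the ledger). [folklore] -/
theorem nonQI_of_nearLineRecurrent (L : R.Lineage a) (h : R.NearLineRecurrent) : R.NonQIRecurrent := by
  intro b
  obtain ⟨j, hj, hN⟩ := h (max a b)
  exact ⟨j + 1, by omega, L.witness j (le_trans (le_max_left _ _) hj) hN⟩

/-- **KERNEL (PROVED) — the `e ≡ 1` column is eventually LEDGER-CURVE-FREE** (no near line can occur when `e = 1`, so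
the ledger dries out; v3: kept as a proved ledger lemma, no longer on the (α) path). [folklore] -/
theorem exists_free_of_dirOne (L : R.Lineage a) {b : ℕ} (h1 : R.DirOneFrom b) :
    ∃ b', b ≤ b' ∧ R.QIFrom b' ∧ ∀ i, b' ≤ i → ∀ c, ¬ L.on i c := by
  have hdry : ∃ j₀, ∀ j, j₀ ≤ j → ¬ R.NearLine j :=
    ⟨b, fun j hj hN => by have := hN.1; have := h1 j hj; simp only [e] at *; omega⟩
  obtain ⟨b₁, -, hq, hfree⟩ := L.exists_free hdry
  exact ⟨max b b₁, le_max_left _ _, R.qiFrom_mono hq (le_max_right _ _),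
    fun i hi => hfree i (le_trans (le_max_right _ _) hi)⟩

end Lineage

/-- **KERNEL (PROVED) — THE LENGTH-ONE CHAIN ADAPTER**: on the stable `e ≡ 2` range the point tower of the
realisation IS a chain of fundamental units of LENGTH ONE (CJS Def. 6.38, convention for length `1`; Def. 6.39):
every clause of the typed `IsFundamentalUnit` for `m = 1` is a field of the realisation or vacuous. [cite:
CossartJannsenSaito2020, Def. 6.38, Def. 6.39] [folklore] -/
theorem isChain {a : ℕ} (hst : R.StableFrom a) (h2 : R.DirTwoFrom a) :
    IsChainOfFundamentalUnits (R.S.drop a) 2 (fun _ => 1) (fun i => R.y (a + unitStart (fun _ => 1) i)) := by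
  intro i
  show IsFundamentalUnit _ 2 1 _ _
  exact
    { one_le_length := le_rfl
      isClosed_point := R.isClosed_y (a + unitStart (fun _ => 1) i)
      dirDim_eq := h2 _ (Nat.le_add_right _ _)
      geomDirDim_eq := R.geomDirDim_of_two _ (h2 _ (Nat.le_add_right _ _))
      centre_zero := R.centre_eq _
      centre_one := fun h => by omega
      centre_near := fun q hq hq' => by omega
      permissible := fun q hq => by
        obtain rfl : q = 0 := by omega
        exact R.permissible _
      iso := fun j hj hj' => by omega
      not_surjective := fun j hj hj' => by omega
      isClosed_terminal := R.isClosed_y (a + unitStart (fun _ => 1) i + 1)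
      terminal_over := by
        rw [BlowupTower.phi_one]
        exact R.y_map (a + unitStart (fun _ => 1) i)
      terminal_near := hst _ (Nat.le_add_right _ _)
      terminal_dirDim := h2 (a + unitStart (fun _ => 1) i + 1) (by omega)
      terminal_geomDirDim := R.geomDirDim_of_two _ (h2 (a + unitStart (fun _ => 1) i + 1) (by omega)) }

end HSRealisation

end Summit.ResolutionOfSingularities.ResolutionOfSingularities.Theorems.NearPointCut
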